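import Literature.NumberTheory.Transcendental.CijsouwWaldschmidt1977Steps
import HarnessLib

/-!
# Waldschmidt 1980, (3.6): the number of derivative multi-indices `|τ| < T` is `binom(T+d, d+1)`

Support file (theorems only; no named facts) for the archimedean input of the Stewart–Yu 1991 line
of `Literature.Barriers.ABC.stewartYu1991_upperBound` (M. Waldschmidt, *A lower bound for linear
forms in logarithms*, Acta Arith. **37** (1980), Prop. 3.8 over `ℚ`, `q = 2`).

Siegel's lemma is applied (Lemma 3.2, p. 266–267) to `binom(T+n, n)(1 − 1/q) S` equations, and the
count (3.6) `(L₋₁+1)(L₀+1)⋯(Lₙ+1) ≥ c₀(1 − 1/q) S binom(T+n, n)` with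
"`binom(T+n, n) ≤ c₀' Tⁿ (c₀ n!)⁻¹`" (p. 264) is where the factor `n!` of `U₂ ∝ n^{2n+1}/n!` — i.e.
the difference between `nⁿ` and `n^{2n}` — comes from. The tree's `CW77.Setup.card_tauSet_le`
(`#tauSet d T ≤ T^{d+1}`) loses this factorial; here the exact count is proved:

* `card_tuplesSum` — `#{τ : Fin m → ℕ, ∑ τᵢ = n} = multichoose(m, n)` (stars and bars, via
  Mathlib's `Sym (Fin m) n` and `Finsupp.toMultiset`);
* `card_tauSet_le_choose` — `#tauSet d T ≤ binom(T + d, d + 1)` (fibres over `|τ|`, the injection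
  `Fin.cons`, and the hockey-stick identity `Nat.sum_Icc_choose`);
* `card_tauSet_le_pow_div_factorial` — `#tauSet d T ≤ (T + d)^{d+1} / (d+1)!` (as reals).

## References

* [Waldschmidt1980] M. Waldschmidt, *A lower bound for linear forms in logarithms*, Acta Arith. 37
  (1980), 257–283 — (3.6) (p. 264) and Lemma 3.2 (pp. 266–267).
-/

noncomputable section

open Finset

namespace Literature.NumberTheory.Transcendental.Waldschmidt1980

open CW77 CW77.Setup

/-! ### Stars and bars for `Fin m → ℕ` -/

/-- The tuples `τ : Fin m → ℕ` with `∑ τᵢ = n` are in bijection with `Sym (Fin m) n` (multisets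
of size `n`), through `Finsupp.toMultiset`. [folklore] -/
def tuplesSumEquivSym (m n : ℕ) : {τ : Fin m → ℕ // ∑ i, τ i = n} ≃ Sym (Fin m) n :=
  Equiv.subtypeEquiv
    ((Finsupp.equivFunOnFinite (α := Fin m) (M := ℕ)).symm.trans Multiset.toFinsupp.symm.toEquiv)
    (fun τ => by
      change (∑ i, τ i = n) ↔ Multiset.card (Multiset.toFinsupp.symm (Finsupp.equivFunOnFinite.symm τ)) = n
      rw [Multiset.toFinsupp_symm_apply, Finsupp.card_toMultiset, Finsupp.sum_fintype _ _ (fun _ => rfl)]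
      rfl)

/-- The subtype of tuples with a given sum is finite. [folklore] -/
instance fintypeTuplesSum (m n : ℕ) : Fintype {τ : Fin m → ℕ // ∑ i, τ i = n} :=
  Fintype.ofEquiv (Sym (Fin m) n) (tuplesSumEquivSym m n).symm

/-- **Stars and bars**: `#{τ : Fin m → ℕ, ∑ τᵢ = n} = multichoose(m, n) = binom(m+n−1, n)`. [folklore] -/
theorem card_tuplesSum (m n : ℕ) :
    Fintype.card {τ : Fin m → ℕ // ∑ i, τ i = n} = m.multichoose n := by
  rw [Fintype.card_congr (tuplesSumEquivSym m n), Sym.card_sym_eq_multichoose, Fintype.card_fin]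

/-- The Finset of tuples in the cube `[0, n]^m` with sum `n` has `multichoose(m, n)` elements.
[folklore] -/
theorem card_filter_piFinset_sum_eq (m n : ℕ) :
    ((Fintype.piFinset fun _ : Fin m => range (n + 1)).filter (fun τ => ∑ i, τ i = n)).card =
      m.multichoose n := by
  classical
  rw [← card_tuplesSum]
  symm
  refine Fintype.card_of_subtype _ fun τ => ?_
  simp only [mem_filter, Fintype.mem_piFinset, mem_range, and_iff_right_iff_imp]
  intro hτ i
  have : τ i ≤ ∑ j, τ j := Finset.single_le_sum (fun j _ => Nat.zero_le _) (mem_univ i)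
  omega

/-! ### The count of `tauSet` -/

/-- `#tauSet d T` as a sum over the value of `|τ|`: the fibre over `n < T` consists of the tuples
`(τ₀, τ') ↦ Fin.cons τ₀ τ'` with sum `n`. We bound the fibre count by `multichoose(d+1, n)` through
the injection `Fin.cons`. [folklore] -/
theorem card_tauSet_le_sum (d T : ℕ) :
    (tauSet d T).card ≤ ∑ n ∈ range T, (d + 1).multichoose n := by
  classical
  -- fibre decomposition over `tauNorm`
  have hfib : (tauSet d T).card = ∑ n ∈ range T, ((tauSet d T).filter fun τ => tauNorm τ = n).card := by
    rw [← Finset.card_biUnion]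
    · congr 1
      ext τ
      simp only [mem_biUnion, mem_range, mem_filter]
      constructor
      · intro h; exact ⟨tauNorm τ, mem_tauSet.mp h, h, rfl⟩
      · rintro ⟨n, _, h, _⟩; exact h
    · intro a _ b _ hab
      simp only [Function.onFun, Finset.disjoint_left, mem_filter]
      rintro τ ⟨_, ha⟩ ⟨_, hb⟩
      exact hab (ha.symm.trans hb)
  rw [hfib]
  refine Finset.sum_le_sum fun n hn => ?_
  rw [mem_range] at hn
  -- inject the fibre into the tuples `Fin (d+1) → ℕ` with sum `n`
  rw [← card_filter_piFinset_sum_eq (d + 1) n]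
  refine Finset.card_le_card_of_injOn (fun τ => Fin.cons τ.1 τ.2) ?_ ?_
  · intro τ hτ
    rw [mem_coe, mem_filter] at hτ
    obtain ⟨_, hn'⟩ := hτ
    unfold tauNorm at hn'
    rw [mem_coe, mem_filter, Fintype.mem_piFinset, Fin.sum_cons]
    refine ⟨fun i => mem_range.mpr ?_, hn'⟩
    refine Nat.lt_succ_of_le ?_
    refine Fin.cases ?_ (fun j => ?_) i
    · dsimp only
      rw [Fin.cons_zero]; omega
    · dsimp only
      rw [Fin.cons_succ]
      have : τ.2 j ≤ ∑ i, τ.2 i := Finset.single_le_sum (fun i _ => Nat.zero_le _) (mem_univ j)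
      omega
  · intro τ _ τ' _ hττ'
    have h0 := congrFun hττ' 0
    simp only [Fin.cons_zero] at h0
    have h1 : τ.2 = τ'.2 := by
      funext j
      have := congrFun hττ' j.succ
      simpa only [Fin.cons_succ] using this
    exact Prod.ext h0 h1

/-- **(3.6): `#tauSet d T ≤ binom(T + d, d + 1)`** (in fact an equality: the multi-indices
`τ ∈ ℕ^{d+1}` with `|τ| < T`). [cite: Waldschmidt1980, (3.6) (p. 264)] -/
theorem card_tauSet_le_choose (d T : ℕ) : (tauSet d T).card ≤ (T + d).choose (d + 1) := by
  refine (card_tauSet_le_sum d T).trans ?_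
  rcases Nat.eq_zero_or_pos T with rfl | hT
  · simp
  · -- `∑_{n<T} multichoose(d+1, n) = ∑_{n<T} binom(n+d, d) = binom(T+d, d+1)`
    have h1 : ∑ n ∈ range T, (d + 1).multichoose n = ∑ n ∈ range T, (n + d).choose d := by
      refine Finset.sum_congr rfl fun n _ => ?_
      rw [Nat.multichoose_eq]
      have : d + 1 + n - 1 = n + d := by omega
      rw [this, Nat.choose_symm_add]
    rw [h1]
    -- hockey stick
    have h2 : ∑ n ∈ range T, (n + d).choose d = ∑ k ∈ Icc d (T - 1 + d), k.choose d := by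
      rw [Finset.range_eq_Ico]
      have : (Finset.Icc d (T - 1 + d)) = (Finset.Ico 0 T).image (fun n => n + d) := by
        ext k
        simp only [mem_Icc, mem_image, mem_Ico]
        constructor
        · intro hk; exact ⟨k - d, by omega, by omega⟩
        · rintro ⟨n, hn, rfl⟩; omega
      rw [this, Finset.sum_image (fun a _ b _ h => by omega)]
    rw [h2, Nat.sum_Icc_choose]
    have : T - 1 + d + 1 = T + d := by omega
    rw [this]

/-- **`#tauSet d T ≤ (T+d)^{d+1}/(d+1)!`** (Waldschmidt: "`binom(T+n,n) ≤ c₀'Tⁿ(c₀n!)⁻¹`"): the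
factorial that makes `nⁿ` rather than `n^{2n}`. [cite: Waldschmidt1980, (3.6) (p. 264)] -/
theorem card_tauSet_le_pow_div_factorial (d T : ℕ) :
    ((tauSet d T).card : ℝ) ≤ ((T : ℝ) + d) ^ (d + 1) / (d + 1).factorial := by
  have h1 : ((tauSet d T).card : ℝ) ≤ ((T + d).choose (d + 1) : ℝ) := by
    exact_mod_cast card_tauSet_le_choose d T
  refine h1.trans ?_
  have h2 := Nat.choose_le_pow_div (d + 1) (T + d) (α := ℝ)
  push_cast at h2
  exact h2

end Literature.NumberTheory.Transcendental.Waldschmidt1980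

end
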